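import Literature.NumberTheory.EllipticCurves.CMFormalActionNilIdealPointsChart
import HarnessLib

/-!
# (CM-POINTS)(ii) ON THE LANE CURVE: `P([π]_{P′} z(U′)) = Z − P₁^α` — the `[π]`-coherence input (N3) of the bridge, from the point identity of
# `CMFormalActionNilIdealPointsChart` on the theta datum's presentation (de Shalit II.4.4 (iv) / II.4.9 (ii) — proofs only)

Topic `NumberTheory/EllipticCurves` (theorems only; no definition, no named fact, no instance).  Cell `bsd-print-cf2`, width seat
`bsd-line-cf2c-w4` g15, brick B10d of the memo `ALPHA-ASSEMBLY-w4g15.md`.  Two presentations of one curve over a finite `M′ ⊆ F̄`: the LANE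
curve `curveOver M′ V` (`V / LTCoeff F`, carrying the Lubin–Tate series `P′ ∈ 𝔉_π` of `V̂`) and the THETA DATUM's `curveOver M′ W_R`
(`W_R / R`, carrying `T_R` = the formal multiplication `[π₀]_Ê`, the base points `(x₀, y₀) = ξ(Ω₁)`, `(x₁, y₁) = ξ(π₀Ω₁)` and the
transformation polynomials; `CMFormalActionReadingSeries/Identities` of the cell), glued by `W_R ⊗_ψ 𝒪_{M′} = V ⊗ 𝒪_{M′}` and
`T_R ⊗_ψ 𝒪_{M′} = P′ ⊗ 𝒪_{M′}`:

* §0 `ptOfZ_eq_some_iff_of_map_algebraMap_eq` — `P(s) = (x, y)` is the same statement on both presentations (coordinates `X(s)/s²`,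
  `−X(s)/s³` agree, `evX_eq_of_map_algebraMap_eq`); `some_add_ptOfZ_eq_some_iff_of_map_algebraMap_eq` (the chart identity `P₁ + P(t) = S`);
* ★★★ `ptOfZ_ltSMul_eq_sub_of_cm_identities` — ON THE LANE CURVE: for `U′ ∈ E₁(M′)` with `P₁ + U′ = (X₀, Y₀)`, a nonsingular
  `Z = (x_Z, y_Z)` satisfying the (X)/(Y) identities of `some_add_ptOfZ_evalPt₁_eq_of_cm_identities` (with `b = 0`) together with
  `Q(X₀) ≠ 0`, `α ≠ 0`, `2 ≠ 0`, and `[π]_{P′}(z(U′)) ≠ 0`:  **`P([π]_{P′}(z(U′))) = Z − P₁^α`** — p766205 on the `R`-presentation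
  (`R` gets the discrete uniformity and the algebra `ψ` INSIDE the proof), `[π]_{P′} = P′` (`hom_self_eq`), `P′(z) = T_R(z)` as points
  (`coe_evalPt₁_eq_evS_map`), and §0.  With `Z − P₁^α = ι(U)` (the point `ξ(u)` read one level up, `DivisionPointsOnLaneCurve`) and
  `zPt` this is the hypothesis (N3) `[π]_{P′} z(U_{m+1}) = ι z(U_m)` of `exists_unit_relColemanSeries_eq_subst_subst_of_divisionPoints`:
  `eq_zPt_of_ptOfZ_eq` (take `zPt` of a point identity `P(s) = U″`, `U″ ∈ E₁`) and `zPt_some_eq_inclPt_zPt_some` (the parameter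
  `−x/y` of a point of `E₁(M)` read in `M′ ⊇ M` is the included parameter).

* §2 (appended, g16) ★★★ `ptOfZ_ltSMul_eq_sub_of_cm_identities_of_hom` — the same identity **`P([c]_{P′}(z(U′))) = Z − P₁^α`** for a
  GENERAL scalar `c` (`T_R ⊗_ψ 𝒪 = [c]_{P′} ⊗ 𝒪`): the CM-formal input of the Tate-unit transport across levels (multiplier a `v`-unit).

No summit statement is proved; BSD is not proved by any of this.

## References
* [deShalit1987] E. de Shalit, *Iwasawa theory of elliptic curves with complex multiplication* (1987), II §4.4 (iv), II §4.9 (ii).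
* [SilvermanAEC2009] J. H. Silverman, *The Arithmetic of Elliptic Curves*, 2nd ed. (2009), VII.2.2.
-/

noncomputable section

open scoped Classical
open PowerSeries

namespace Literature.NumberTheory.EllipticCurves

open Literature.NumberTheory.GaloisRepresentations Literature.NumberTheory.GaloisRepresentations.LubinTate
open Literature.NumberTheory.EllipticCurves.FormalGroupChart _root_.WeierstrassCurve

/-! ## §0 `P(s) = (x, y)` and `P₁ + P(t) = S` across two presentations -/

section Presentation

variable {A₁ : Type*} [CommRing A₁] [UniformSpace A₁] [DiscreteUniformity A₁]
  {A₂ : Type*} [CommRing A₂] [UniformSpace A₂] [DiscreteUniformity A₂]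
  {K : Type*} [NontriviallyNormedField K] [IsUltrametricDist K] [CompleteSpace K]
  [Algebra A₁ (unitBall K)] [ContinuousSMul A₁ (unitBall K)] [Algebra A₂ (unitBall K)] [ContinuousSMul A₂ (unitBall K)]
  {W₁ : WeierstrassCurve A₁} {W₂ : WeierstrassCurve A₂}

/-- **`P(s) = (x, y)` is presentation-independent** (`t ≠ 0`: both are `(X(s)/s², −X(s)/s³)` with the same `X(s)`).
[cite: SilvermanAEC2009, VII.2.2] -/
theorem ptOfZ_eq_some_iff_of_map_algebraMap_eq [(curveOver K W₁).IsElliptic] [(curveOver K W₂).IsElliptic]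
    (h : W₁.map (algebraMap A₁ (unitBall K)) = W₂.map (algebraMap A₂ (unitBall K))) {s : (ballNilIdeal K).toIdeal}
    (hs0 : ((s : unitBall K) : K) ≠ 0) {x y : K}
    {h₁ : (curveOver K W₁).toAffine.Nonsingular x y} {h₂ : (curveOver K W₂).toAffine.Nonsingular x y} :
    ptOfZ K W₁ s = .some x y h₁ ↔ ptOfZ K W₂ s = .some x y h₂ := by
  rw [ptOfZ_of_ne_zero hs0, ptOfZ_of_ne_zero hs0]
  simp only [Affine.Point.some.injEq, evX_eq_of_map_algebraMap_eq (K := K) h s]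

/-- **`P₁ + P(t) = S` is presentation-independent** (for `t ≠ 0`; `DecidableEq` instance an implicit argument).
[cite: SilvermanAEC2009, III.2.3, VII.2.2] -/
theorem some_add_ptOfZ_eq_some_iff_of_map_algebraMap_eq {dec : DecidableEq K} [(curveOver K W₁).IsElliptic] [(curveOver K W₂).IsElliptic]
    (h : W₁.map (algebraMap A₁ (unitBall K)) = W₂.map (algebraMap A₂ (unitBall K))) {X₁ Y₁ X₀ Y₀ : K}
    {h₁ : (curveOver K W₁).toAffine.Nonsingular X₁ Y₁} {h₁' : (curveOver K W₂).toAffine.Nonsingular X₁ Y₁}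
    {hS : (curveOver K W₁).toAffine.Nonsingular X₀ Y₀} {hS' : (curveOver K W₂).toAffine.Nonsingular X₀ Y₀}
    {t : (ballNilIdeal K).toIdeal} (ht0 : ((t : unitBall K) : K) ≠ 0) :
    (.some X₁ Y₁ h₁ : (curveOver K W₁).toAffine.Point) + ptOfZ K W₁ t = .some X₀ Y₀ hS ↔
      (.some X₁ Y₁ h₁' : (curveOver K W₂).toAffine.Point) + ptOfZ K W₂ t = .some X₀ Y₀ hS' := by
  have hC := curveOver_eq_of_map_algebraMap_eq (K := K) h
  have hX := evX_eq_of_map_algebraMap_eq (K := K) h t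
  rw [ptOfZ_of_ne_zero ht0, ptOfZ_of_ne_zero ht0]
  -- both sides: non-degenerate addition with explicit coordinates; compare through `addX`/`addY`
  constructor
  · intro he
    have hnd : ¬ (X₁ = evX W₁ t / ((t : unitBall K) : K) ^ 2 ∧
        Y₁ = (curveOver K W₁).toAffine.negY (evX W₁ t / ((t : unitBall K) : K) ^ 2) (-evX W₁ t / ((t : unitBall K) : K) ^ 3)) := by
      intro hxy
      rw [Affine.Point.add_of_Y_eq hxy.1 hxy.2] at he
      exact absurd he (Affine.Point.some_ne_zero _).symm
    rw [Affine.Point.add_some hnd] at he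
    simp only [Affine.Point.some.injEq] at he
    have hnd' : ¬ (X₁ = evX W₂ t / ((t : unitBall K) : K) ^ 2 ∧
        Y₁ = (curveOver K W₂).toAffine.negY (evX W₂ t / ((t : unitBall K) : K) ^ 2) (-evX W₂ t / ((t : unitBall K) : K) ^ 3)) := by
      rw [← hX, ← hC]; exact hnd
    rw [Affine.Point.add_some hnd']
    simp only [Affine.Point.some.injEq, ← hX, ← hC]
    exact he
  · intro he
    have hnd : ¬ (X₁ = evX W₂ t / ((t : unitBall K) : K) ^ 2 ∧
        Y₁ = (curveOver K W₂).toAffine.negY (evX W₂ t / ((t : unitBall K) : K) ^ 2) (-evX W₂ t / ((t : unitBall K) : K) ^ 3)) := by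
      intro hxy
      rw [Affine.Point.add_of_Y_eq hxy.1 hxy.2] at he
      exact absurd he (Affine.Point.some_ne_zero _).symm
    rw [Affine.Point.add_some hnd] at he
    simp only [Affine.Point.some.injEq] at he
    have hnd' : ¬ (X₁ = evX W₁ t / ((t : unitBall K) : K) ^ 2 ∧
        Y₁ = (curveOver K W₁).toAffine.negY (evX W₁ t / ((t : unitBall K) : K) ^ 2) (-evX W₁ t / ((t : unitBall K) : K) ^ 3)) := by
      rw [hX, hC]; exact hnd
    rw [Affine.Point.add_some hnd']
    simp only [Affine.Point.some.injEq, hX, hC]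
    exact he

end Presentation

/-! ## §1 On the lane curve: `P([π]_{P′} z(U′)) = Z − P₁^α` -/

section Lane

variable {F : Type} [Field F] [ValuativeRel F] [TopologicalSpace F] [IsNonarchimedeanLocalField F]

attribute [local instance] ltNormUniformSpace ltNormIsUniformAddGroup rk1 nF nE fintypeResidueField

variable (M' : IntermediateField F (AlgebraicClosure F)) [FiniteDimensional F M']
  {πL : LTCoeff F} {q : ℕ} (hA : IsLTRing πL q) {P' : PowerSeries (LTCoeff F)} (hP' : IsLTSeries πL q P')
  (V : WeierstrassCurve (LTCoeff F)) [hV : (curveOver M' V).IsElliptic]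

set_option maxHeartbeats 1600000 in
/-- ★★★ **`P([π]_{P′} z(U′)) = Z − P₁^α` on the lane curve** — see the module docstring.  Hypotheses: the theta presentation
(`ψ : R → 𝒪_{M′}`, `W_R ⊗_ψ 𝒪 = V ⊗ 𝒪`, `T_R ⊗_ψ 𝒪 = P′ ⊗ 𝒪`, the series identities `hidX`/`hidY` over `R` — `CMFormalActionReadingIdentities`),
`U′ ∈ E₁(M′)` with `P₁ + U′ = (X₀, Y₀)` ON THE LANE CURVE, a nonsingular `Z` with the (X)/(Y) identities (`CMChartIdentitiesOfTransformation` +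
transport), `Q(X₀ + b) ≠ 0`, `α ≠ 0`, `2 ≠ 0`, and `[π]_{P′}(z(U′)) ≠ 0`. [cite: deShalit1987, II §4.4 (iv), II §4.9 (ii)] [cite: SilvermanAEC2009, VII.2.2] -/
theorem ptOfZ_ltSMul_eq_sub_of_cm_identities {dec : DecidableEq M'}
    {R : Type*} [CommRing R] (ψ : R →+* unitBall M') (WR : WeierstrassCurve R)
    (hWR : WR.map ψ = V.map (algebraMap (LTCoeff F) (unitBall M')))
    {T : PowerSeries R} (hT0 : constantCoeff T = 0) (hTP : T.map ψ = P'.map (algebraMap (LTCoeff F) (unitBall M')))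
    {x₀ y₀ x₁ y₁ b α : R} {P Q : Polynomial R}
    (hidX : ((WR.translateX x₁ y₁).subst T + C b) * Polynomial.aeval (WR.translateX x₀ y₀ + C b) Q =
      Polynomial.aeval (WR.translateX x₀ y₀ + C b) P)
    (hidY : C α * (2 * PowerSeries.subst T (WR.translateY x₁ y₁) + C WR.a₁ * PowerSeries.subst T (WR.translateX x₁ y₁) + C WR.a₃) *
          Polynomial.aeval (WR.translateX x₀ y₀ + C b) Q +
        (PowerSeries.subst T (WR.translateX x₁ y₁) + C b) * Polynomial.aeval (WR.translateX x₀ y₀ + C b) (Polynomial.derivative Q) *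
          (2 * WR.translateY x₀ y₀ + C WR.a₁ * WR.translateX x₀ y₀ + C WR.a₃) =
      Polynomial.aeval (WR.translateX x₀ y₀ + C b) (Polynomial.derivative P) *
        (2 * WR.translateY x₀ y₀ + C WR.a₁ * WR.translateX x₀ y₀ + C WR.a₃))
    {U' : (curveOver M' V).toAffine.Point} (hU' : U' ∈ kernel (NormedField.valuation (K := M')) (curveOver M' V))
    (h₀ : (curveOver M' V).toAffine.Nonsingular ((ψ x₀ : unitBall M') : M') ((ψ y₀ : unitBall M') : M'))
    (h₁ : (curveOver M' V).toAffine.Nonsingular ((ψ x₁ : unitBall M') : M') ((ψ y₁ : unitBall M') : M'))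
    {X₀ Y₀ : M'} {hS : (curveOver M' V).toAffine.Nonsingular X₀ Y₀}
    (hsum : (.some _ _ h₀ : (curveOver M' V).toAffine.Point) + U' = .some X₀ Y₀ hS)
    {xZ yZ : M'} (hZ : (curveOver M' V).toAffine.Nonsingular xZ yZ)
    (hQ : Q.eval₂ ((unitBall M').subtype.comp ψ) (X₀ + ((ψ b : unitBall M') : M')) ≠ 0)
    (hα : ((ψ α : unitBall M') : M') ≠ 0) (h2 : (2 : M') ≠ 0)
    (hZx : (xZ + ((ψ b : unitBall M') : M')) * Q.eval₂ ((unitBall M').subtype.comp ψ) (X₀ + ((ψ b : unitBall M') : M')) =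
      P.eval₂ ((unitBall M').subtype.comp ψ) (X₀ + ((ψ b : unitBall M') : M')))
    (hZy : ((ψ α : unitBall M') : M') * (2 * yZ + ((ψ WR.a₁ : unitBall M') : M') * xZ + ((ψ WR.a₃ : unitBall M') : M')) *
          Q.eval₂ ((unitBall M').subtype.comp ψ) (X₀ + ((ψ b : unitBall M') : M')) +
        (xZ + ((ψ b : unitBall M') : M')) * (Polynomial.derivative Q).eval₂ ((unitBall M').subtype.comp ψ) (X₀ + ((ψ b : unitBall M') : M')) *
          (2 * Y₀ + ((ψ WR.a₁ : unitBall M') : M') * X₀ + ((ψ WR.a₃ : unitBall M') : M')) =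
      (Polynomial.derivative P).eval₂ ((unitBall M').subtype.comp ψ) (X₀ + ((ψ b : unitBall M') : M')) *
        (2 * Y₀ + ((ψ WR.a₁ : unitBall M') : M') * X₀ + ((ψ WR.a₃ : unitBall M') : M')))
    (hs0 : (((ltSMul (maxNilIdeal F M') hA hP' πL (zPt U' hU') : (maxNilIdeal F M').toIdeal) : unitBall M') : M') ≠ 0) :
    ptOfZ M' V (ltSMul (maxNilIdeal F M') hA hP' πL (zPt U' hU')) =
      .some xZ yZ hZ - (.some _ _ h₁ : (curveOver M' V).toAffine.Point) := by
  obtain rfl : dec = fun a b => Classical.propDecidable (a = b) := Subsingleton.elim _ _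
  letI dM : DecidableEq M' := fun a b => Classical.propDecidable (a = b)
  -- `R` as a discrete coefficient ring acting on `𝒪_{M′}` through `ψ`
  letI : UniformSpace R := ⊥
  haveI : DiscreteUniformity R := ⟨rfl⟩
  letI : Algebra R (unitBall M') := ψ.toAlgebra
  have halg : algebraMap R (unitBall M') = ψ := rfl
  haveI : ContinuousSMul R (unitBall M') := by
    refine ⟨continuous_prod_of_discrete_left.mpr fun a => ?_⟩
    change Continuous fun s : unitBall M' => ψ a * s
    exact continuous_const_mul _
  have hpres : V.map (algebraMap (LTCoeff F) (unitBall M')) = WR.map (algebraMap R (unitBall M')) := by rw [halg, hWR]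
  have hC := curveOver_eq_of_map_algebraMap_eq (K := M') hpres
  haveI : (curveOver M' WR).IsElliptic := hC ▸ hV
  -- the parameter `t = z(U′)` and `U′ = P(t)`
  set t : (ballNilIdeal M').toIdeal := zPt U' hU' with ht
  have hUeq : U' = ptOfZ M' V t := eq_ptOfZ_zPt hU'
  -- `[π]_{P′} t = T_R(t)` as points of `𝔪_{M′}`
  have e1 : (ltSMul (maxNilIdeal F M') hA hP' πL t : (maxNilIdeal F M').toIdeal) = evalPt₁ (ballNilIdeal M') T hT0 t := by
    apply Subtype.ext
    change ((evalPt₁ (maxNilIdeal F M') (hom hA hP' hP' πL) (constantCoeff_hom hA hP' hP' πL) t :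
      (maxNilIdeal F M').toIdeal) : unitBall M') = _
    rw [coe_evalPt₁_eq_evS_map, coe_evalPt₁_eq_evS_map, hom_self_eq hA hP', halg, hTP]
    rfl
  have ht0 : ((t : unitBall M') : M') ≠ 0 := by
    intro h0
    apply hs0
    have : t = 0 := Subtype.ext (Subtype.ext h0)
    rw [this]
    change (((ltSMul (maxNilIdeal F M') hA hP' πL 0 : (maxNilIdeal F M').toIdeal) : unitBall M') : M') = 0
    rw [ltSMul, LubinTate.evalPt₁_zero]
    rfl
  have hTt0 : (((evalPt₁ (ballNilIdeal M') T hT0 t : (ballNilIdeal M').toIdeal) : unitBall M') : M') ≠ 0 := by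
    rw [← e1]; exact hs0
  -- nonsingularity witnesses on the `R`-curve
  have h₀R : (curveOver M' WR).toAffine.Nonsingular (cK M' x₀) (cK M' y₀) := hC ▸ h₀
  have h₁R : (curveOver M' WR).toAffine.Nonsingular (cK M' x₁) (cK M' y₁) := hC ▸ h₁
  have hSR : (curveOver M' WR).toAffine.Nonsingular X₀ Y₀ := hC ▸ hS
  have hZR : (curveOver M' WR).toAffine.Nonsingular xZ yZ := hC ▸ hZ
  -- `P₁ + P(t) = (X₀, Y₀)` on the `R`-curve
  rw [hUeq] at hsum
  have hsumR : (.some _ _ h₀R : (curveOver M' WR).toAffine.Point) + ptOfZ M' WR t = .some X₀ Y₀ hSR :=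
    (some_add_ptOfZ_eq_some_iff_of_map_algebraMap_eq (K := M') hpres ht0).mp hsum
  -- (CM-POINTS)(ii) on the `R`-curve
  have main := ptOfZ_evalPt₁_eq_sub_of_cm_identities (K := M') (W := WR) hT0 hidX hidY h₀R h₁R ht0 hTt0 hsumR hZR hQ hα h2 hZx hZy
  -- back to the lane curve
  rw [eq_sub_iff_add_eq, add_comm] at main ⊢
  rw [e1]
  exact (some_add_ptOfZ_eq_some_iff_of_map_algebraMap_eq (K := M') hpres hTt0).mpr main

/-- **Taking `zPt`**: if `P(s) = U″` for `U″ ∈ E₁(M′)` then `s = z(U″)` — the form (N3) needs (`s = [π]_{P′} z(U′)`, `U″ = ι U`).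
[cite: SilvermanAEC2009, VII.2.2] -/
theorem eq_zPt_of_ptOfZ_eq {s : (ballNilIdeal M').toIdeal} {U'' : (curveOver M' V).toAffine.Point}
    (hU'' : U'' ∈ kernel (NormedField.valuation (K := M')) (curveOver M' V)) (h : ptOfZ M' V s = U'') :
    s = zPt U'' hU'' := by
  subst h
  exact (zPt_ptOfZ s).symm

omit hV in
/-- **The parameter of a point read one level up is the included parameter**: for `M ≤ M′` and points `(X, Y) ∈ E₁(M)`,
`(X′, Y′) ∈ E₁(M′)` of the lane curve with the same coordinates in `F̄`, `z((X′, Y′)) = ι z((X, Y))` (`z = −x/y`).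
[cite: SilvermanAEC2009, VII.2.2] -/
theorem zPt_some_eq_inclPt_zPt_some [(curveOver M' V).IsElliptic] {M : IntermediateField F (AlgebraicClosure F)} [FiniteDimensional F M] (hle : M ≤ M')
    [(curveOver M V).IsElliptic] {X Y : M} {X' Y' : M'} {h : (curveOver M V).toAffine.Nonsingular X Y}
    {h' : (curveOver M' V).toAffine.Nonsingular X' Y'}
    (hU : (.some X Y h : (curveOver M V).toAffine.Point) ∈ kernel (NormedField.valuation (K := M)) (curveOver M V))
    (hU' : (.some X' Y' h' : (curveOver M' V).toAffine.Point) ∈ kernel (NormedField.valuation (K := M')) (curveOver M' V))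
    (hX : ((X' : M') : AlgebraicClosure F) = X) (hY : ((Y' : M') : AlgebraicClosure F) = Y) :
    zPt (.some X' Y' h') hU' = inclPt hle (zPt (.some X Y h) hU) := by
  apply Subtype.ext; apply Subtype.ext; apply Subtype.ext
  rw [coe_inclPt]
  change (((-X' / Y' : M') : AlgebraicClosure F)) = (((-X / Y : M)) : AlgebraicClosure F)
  push_cast
  rw [hX, hY]

/-! ## §2 Appended (cf2c-w4 g16): the same for a general scalar `[c]_{P′}` (TATE-UNIT-CM input) -/

set_option maxHeartbeats 1600000 in
/-- ★★★ **`P([c]_{P′} z(U′)) = Z − P₁^α` on the lane curve, for a GENERAL scalar `c ∈ 𝒪`** (appended, cf2c-w4 g16: the CM multiplier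
`α` need not be the uniformizer — for the Tate-unit transport across levels, TATE-UNIT-CM, `α` is a `v`-adic unit).  Hypotheses as in
`ptOfZ_ltSMul_eq_sub_of_cm_identities` except that the formal CM action `T_R` reads the Lubin–Tate ENDOMORPHISM `[c]_{P′}`
(`T_R ⊗_ψ 𝒪 = [c]_{P′} ⊗ 𝒪`, hypothesis `hTP`) instead of `P′ = [π]_{P′}`; the theta presentation
(`ψ : R → 𝒪_{M′}`, `W_R ⊗_ψ 𝒪 = V ⊗ 𝒪`, the series identities `hidX`/`hidY` over `R` — `CMFormalActionReadingIdentities`),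
`U′ ∈ E₁(M′)` with `P₁ + U′ = (X₀, Y₀)` ON THE LANE CURVE, a nonsingular `Z` with the (X)/(Y) identities (`CMChartIdentitiesOfTransformation` +
transport), `Q(X₀ + b) ≠ 0`, `α ≠ 0`, `2 ≠ 0`, and `[π]_{P′}(z(U′)) ≠ 0`. [cite: deShalit1987, II §4.4 (iv), II §4.9 (ii)] [cite: SilvermanAEC2009, VII.2.2] -/
theorem ptOfZ_ltSMul_eq_sub_of_cm_identities_of_hom {dec : DecidableEq M'} (c : LTCoeff F)
    {R : Type*} [CommRing R] (ψ : R →+* unitBall M') (WR : WeierstrassCurve R)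
    (hWR : WR.map ψ = V.map (algebraMap (LTCoeff F) (unitBall M')))
    {T : PowerSeries R} (hT0 : constantCoeff T = 0)
    (hTP : T.map ψ = (hom hA hP' hP' c).map (algebraMap (LTCoeff F) (unitBall M')))
    {x₀ y₀ x₁ y₁ b α : R} {P Q : Polynomial R}
    (hidX : ((WR.translateX x₁ y₁).subst T + C b) * Polynomial.aeval (WR.translateX x₀ y₀ + C b) Q =
      Polynomial.aeval (WR.translateX x₀ y₀ + C b) P)
    (hidY : C α * (2 * PowerSeries.subst T (WR.translateY x₁ y₁) + C WR.a₁ * PowerSeries.subst T (WR.translateX x₁ y₁) + C WR.a₃) *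
          Polynomial.aeval (WR.translateX x₀ y₀ + C b) Q +
        (PowerSeries.subst T (WR.translateX x₁ y₁) + C b) * Polynomial.aeval (WR.translateX x₀ y₀ + C b) (Polynomial.derivative Q) *
          (2 * WR.translateY x₀ y₀ + C WR.a₁ * WR.translateX x₀ y₀ + C WR.a₃) =
      Polynomial.aeval (WR.translateX x₀ y₀ + C b) (Polynomial.derivative P) *
        (2 * WR.translateY x₀ y₀ + C WR.a₁ * WR.translateX x₀ y₀ + C WR.a₃))
    {U' : (curveOver M' V).toAffine.Point} (hU' : U' ∈ kernel (NormedField.valuation (K := M')) (curveOver M' V))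
    (h₀ : (curveOver M' V).toAffine.Nonsingular ((ψ x₀ : unitBall M') : M') ((ψ y₀ : unitBall M') : M'))
    (h₁ : (curveOver M' V).toAffine.Nonsingular ((ψ x₁ : unitBall M') : M') ((ψ y₁ : unitBall M') : M'))
    {X₀ Y₀ : M'} {hS : (curveOver M' V).toAffine.Nonsingular X₀ Y₀}
    (hsum : (.some _ _ h₀ : (curveOver M' V).toAffine.Point) + U' = .some X₀ Y₀ hS)
    {xZ yZ : M'} (hZ : (curveOver M' V).toAffine.Nonsingular xZ yZ)
    (hQ : Q.eval₂ ((unitBall M').subtype.comp ψ) (X₀ + ((ψ b : unitBall M') : M')) ≠ 0)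
    (hα : ((ψ α : unitBall M') : M') ≠ 0) (h2 : (2 : M') ≠ 0)
    (hZx : (xZ + ((ψ b : unitBall M') : M')) * Q.eval₂ ((unitBall M').subtype.comp ψ) (X₀ + ((ψ b : unitBall M') : M')) =
      P.eval₂ ((unitBall M').subtype.comp ψ) (X₀ + ((ψ b : unitBall M') : M')))
    (hZy : ((ψ α : unitBall M') : M') * (2 * yZ + ((ψ WR.a₁ : unitBall M') : M') * xZ + ((ψ WR.a₃ : unitBall M') : M')) *
          Q.eval₂ ((unitBall M').subtype.comp ψ) (X₀ + ((ψ b : unitBall M') : M')) +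
        (xZ + ((ψ b : unitBall M') : M')) * (Polynomial.derivative Q).eval₂ ((unitBall M').subtype.comp ψ) (X₀ + ((ψ b : unitBall M') : M')) *
          (2 * Y₀ + ((ψ WR.a₁ : unitBall M') : M') * X₀ + ((ψ WR.a₃ : unitBall M') : M')) =
      (Polynomial.derivative P).eval₂ ((unitBall M').subtype.comp ψ) (X₀ + ((ψ b : unitBall M') : M')) *
        (2 * Y₀ + ((ψ WR.a₁ : unitBall M') : M') * X₀ + ((ψ WR.a₃ : unitBall M') : M')))
    (hs0 : (((ltSMul (maxNilIdeal F M') hA hP' c (zPt U' hU') : (maxNilIdeal F M').toIdeal) : unitBall M') : M') ≠ 0) :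
    ptOfZ M' V (ltSMul (maxNilIdeal F M') hA hP' c (zPt U' hU')) =
      .some xZ yZ hZ - (.some _ _ h₁ : (curveOver M' V).toAffine.Point) := by
  obtain rfl : dec = fun a b => Classical.propDecidable (a = b) := Subsingleton.elim _ _
  letI dM : DecidableEq M' := fun a b => Classical.propDecidable (a = b)
  -- `R` as a discrete coefficient ring acting on `𝒪_{M′}` through `ψ`
  letI : UniformSpace R := ⊥
  haveI : DiscreteUniformity R := ⟨rfl⟩
  letI : Algebra R (unitBall M') := ψ.toAlgebra
  have halg : algebraMap R (unitBall M') = ψ := rfl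
  haveI : ContinuousSMul R (unitBall M') := by
    refine ⟨continuous_prod_of_discrete_left.mpr fun a => ?_⟩
    change Continuous fun s : unitBall M' => ψ a * s
    exact continuous_const_mul _
  have hpres : V.map (algebraMap (LTCoeff F) (unitBall M')) = WR.map (algebraMap R (unitBall M')) := by rw [halg, hWR]
  have hC := curveOver_eq_of_map_algebraMap_eq (K := M') hpres
  haveI : (curveOver M' WR).IsElliptic := hC ▸ hV
  -- the parameter `t = z(U′)` and `U′ = P(t)`
  set t : (ballNilIdeal M').toIdeal := zPt U' hU' with ht
  have hUeq : U' = ptOfZ M' V t := eq_ptOfZ_zPt hU'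
  -- `[c]_{P′} t = T_R(t)` as points of `𝔪_{M′}`
  have e1 : (ltSMul (maxNilIdeal F M') hA hP' c t : (maxNilIdeal F M').toIdeal) = evalPt₁ (ballNilIdeal M') T hT0 t := by
    apply Subtype.ext
    change ((evalPt₁ (maxNilIdeal F M') (hom hA hP' hP' c) (constantCoeff_hom hA hP' hP' c) t :
      (maxNilIdeal F M').toIdeal) : unitBall M') = _
    rw [coe_evalPt₁_eq_evS_map, coe_evalPt₁_eq_evS_map, halg, hTP]
    rfl
  have ht0 : ((t : unitBall M') : M') ≠ 0 := by
    intro h0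
    apply hs0
    have : t = 0 := Subtype.ext (Subtype.ext h0)
    rw [this]
    change (((ltSMul (maxNilIdeal F M') hA hP' c 0 : (maxNilIdeal F M').toIdeal) : unitBall M') : M') = 0
    rw [ltSMul, LubinTate.evalPt₁_zero]
    rfl
  have hTt0 : (((evalPt₁ (ballNilIdeal M') T hT0 t : (ballNilIdeal M').toIdeal) : unitBall M') : M') ≠ 0 := by
    rw [← e1]; exact hs0
  -- nonsingularity witnesses on the `R`-curve
  have h₀R : (curveOver M' WR).toAffine.Nonsingular (cK M' x₀) (cK M' y₀) := hC ▸ h₀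
  have h₁R : (curveOver M' WR).toAffine.Nonsingular (cK M' x₁) (cK M' y₁) := hC ▸ h₁
  have hSR : (curveOver M' WR).toAffine.Nonsingular X₀ Y₀ := hC ▸ hS
  have hZR : (curveOver M' WR).toAffine.Nonsingular xZ yZ := hC ▸ hZ
  -- `P₁ + P(t) = (X₀, Y₀)` on the `R`-curve
  rw [hUeq] at hsum
  have hsumR : (.some _ _ h₀R : (curveOver M' WR).toAffine.Point) + ptOfZ M' WR t = .some X₀ Y₀ hSR :=
    (some_add_ptOfZ_eq_some_iff_of_map_algebraMap_eq (K := M') hpres ht0).mp hsum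
  -- (CM-POINTS)(ii) on the `R`-curve
  have main := ptOfZ_evalPt₁_eq_sub_of_cm_identities (K := M') (W := WR) hT0 hidX hidY h₀R h₁R ht0 hTt0 hsumR hZR hQ hα h2 hZx hZy
  -- back to the lane curve
  rw [eq_sub_iff_add_eq, add_comm] at main ⊢
  rw [e1]
  exact (some_add_ptOfZ_eq_some_iff_of_map_algebraMap_eq (K := M') hpres hTt0).mpr main

end Lane

end Literature.NumberTheory.EllipticCurves

end
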